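import Summits.NavierStokesRegularity.NavierStokesRegularity.Theorems.EulerZoomLiouvillePowerGaugeEulerLiouvilleClassicalProfileRigidity

/-!
# Crux `EulerZoomLiouville.PowerGaugeEulerLiouville` (stmt-NavierStokesRegularity-19832), line `logtime-breathers`:
# RIGIDITY AT `β = 0` — a classical solution of `α V + (V·∇)V + ∇P = 0` (`α ≠ 0`) with large-scale class data vanishes

Width seat `ns-ezl-w4` (power-clock rigidity, file VIII; the `β = 0` companion of `…ClassicalProfileRigidity`).  Let `V, P ∈ C¹`,
`div V = 0`, `α V + (V·∇)V + ∇P = 0` with `α ≠ 0` (the generalised profile equation with `β = 0`: the power clock of rate `γ = 0`,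
`u(τ, y) = (T₀−τ)^{−1} W(y)`), and suppose `(V, ∇V, P)` carry the thresholded large-scale class data (A₁), (E₁), (D₁) (`0 < ρ < 1`).
Then `V = 0`: the classical local energy equality degenerates to `2α ∫σ_L|V|² = F_σ(L)` (no scale derivative), so the flux bound
`|F_σ(r)| ≲ S^{1/2} r^{1−2ρ−a}` of `EnergySaturation.exists_fluxWeight_le_of_sup_loc` gives `N(R) ≤ B₀ S^{1/2} L^{−a}` on `[L, ∞)`
at once, and the absorption of `EnergySaturation.ae_eq_zero_of_subExtremal_loc` concludes.

WHAT THIS IS NOT: not NS regularity, not the crux — a rigidity lemma for classical shape-preserving members of the crux CLASS 19832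
(MODEL lattice); `--supports` stmt-19832. [folklore]
-/

noncomputable section

set_option linter.dupNamespace false

open MeasureTheory Set Filter Topology Metric Function TopologicalSpace
open scoped ENNReal NNReal RealInnerProductSpace ContDiff Laplacian

namespace Summit.NavierStokesRegularity.NavierStokesRegularity.Theorems.PowerGaugeEulerLiouville

open Literature.Analysis Literature.Analysis.FunctionSpaces Literature.Analysis.FluidPDE

namespace ClassicalProfile

variable {V : EuclideanSpace ℝ (Fin 3) → EuclideanSpace ℝ (Fin 3)} {P : EuclideanSpace ℝ (Fin 3) → ℝ}

/-- **RIGIDITY AT `β = 0`.**  Let `V, P ∈ C¹`, `div V = 0`, `α V + 0·(y·∇)V + (V·∇)V + ∇P = 0` pointwise with `α ≠ 0`, and let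
`(V, ∇V, P)` satisfy, for `L ≥ 1`, `∫_{B_L}|V|² ≤ c' L^{1−2ρ}`, `∫_{B_L}|∇V|²_F ≤ L^{1−ρ}((1−ρ)/(2+ρ))c'`,
`∫_{B_L}|P|^{3/2} ≤ L^{2−2ρ}((2−2ρ)/(2+ρ))c'` (`0 < ρ < 1`).  Then `V = 0`. [folklore] -/
theorem eq_zero_of_locData_of_beta_zero {ρ : ℝ} (hρ : 0 < ρ) (hρ1 : ρ < 1)
    (hV1 : ContDiff ℝ 1 V) (hP1 : ContDiff ℝ 1 P) (hdiv : VectorCalculus.IsDivFree V)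
    {α : ℝ} (hα : α ≠ 0)
    (heq : ∀ x, α • V x + (0 : ℝ) • fderiv ℝ V x x + fderiv ℝ V x (V x) + gradient P x = 0) {c' : ℝ≥0}
    (hA : ∀ L : ℝ, 1 ≤ L → ∫⁻ y in ball (0 : EuclideanSpace ℝ (Fin 3)) L, ‖V y‖ₑ ^ 2 ≤
      (c' : ℝ≥0∞) * ENNReal.ofReal (L ^ (1 - 2 * ρ)))
    (hE : ∀ L : ℝ, 1 ≤ L →
      ∫⁻ y in ball (0 : EuclideanSpace ℝ (Fin 3)) L, ENNReal.ofReal (frobeniusNormSq (fderiv ℝ V y)) ≤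
        ENNReal.ofReal (L ^ (1 - ρ)) * (ENNReal.ofReal ((1 - ρ) / (2 + ρ)) * (c' : ℝ≥0∞)))
    (hD : ∀ L : ℝ, 1 ≤ L →
      ∫⁻ y in ball (0 : EuclideanSpace ℝ (Fin 3)) L, ‖P y‖ₑ ^ (3 / 2 : ℝ) ≤
        ENNReal.ofReal (L ^ (2 - 2 * ρ)) * (ENNReal.ofReal ((2 - 2 * ρ) / (2 + ρ)) * (c' : ℝ≥0∞))) :
    V = 0 := by
  have h2ρ : (0 : ℝ) < 2 + ρ := by linarith
  have hc0 : (0 : ℝ) ≤ c' := c'.2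
  have hVc : Continuous V := hV1.continuous
  have hVm : AEStronglyMeasurable V volume := hVc.aestronglyMeasurable
  have hPm : AEStronglyMeasurable P volume := hP1.continuous.aestronglyMeasurable
  have hGm : AEStronglyMeasurable (fderiv ℝ V) volume := (hV1.continuous_fderiv one_ne_zero).aestronglyMeasurable
  have hVG : HasWeakFDerivOn (⊤ : Opens (EuclideanSpace ℝ (Fin 3))) volume V (fderiv ℝ V) :=
    hasWeakGradient_fderiv_of_contDiff hV1
  have hPoisson : ∀ θ : EuclideanSpace ℝ (Fin 3) → ℝ, ContDiff ℝ (⊤ : ℕ∞) θ → HasCompactSupport θ →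
      ∫ y, P y * (Δ θ) y = -∫ y, fderiv ℝ (fderiv ℝ θ) y (V y) (V y) :=
    fun θ hθ hθc => pressure_poisson hV1 hP1 hdiv heq (hθ.of_le (by norm_cast)) hθc
  have hV2 : LocallyIntegrable (fun y => ‖V y‖ ^ 2) volume :=
    EnergySaturation.locallyIntegrable_norm_sq_of_growth_loc hVm hA
  -- ### the radial cut-off and the breather local energy equality at every scale
  obtain ⟨σ, hσs, hσc, h0, h1, hone, hzero, -⟩ := exists_radialCutoff
  have hσ : IsTestFunctionOn (⊤ : Opens (EuclideanSpace ℝ (Fin 3))) σ := ⟨hσs, hσc, fun _ _ => trivial⟩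
  have hσ1 : ContDiff ℝ 1 σ := hσs.of_le (by exact_mod_cast le_top)
  have hEEσ : ∀ L : ℝ, 0 < L → (2 * α) * ∫ x, σ (L⁻¹ • x) * ‖V x‖ ^ 2 =
      ∫ x, (‖V x‖ ^ 2 + 2 * P x) * ⟪V x, gradient (fun z => σ (L⁻¹ • z)) x⟫ := by
    intro L hL
    have h := ClassicalProfile.local_energy_equality hV1 hP1 hdiv heq (hσ1.comp (contDiff_const_smul L⁻¹))
      (hσc.comp_smul (inv_ne_zero hL.ne'))
    simp only [mul_zero, sub_zero, zero_mul, add_zero] at h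
    exact h
  -- ### the normalised energy `N`
  set N : ℝ → ℝ := fun R => R ^ (2 * ρ - 1) * ∫ y, σ (R⁻¹ • y) * ‖V y‖ ^ 2 with hN
  have hI0 : ∀ R : ℝ, 0 ≤ ∫ y, σ (R⁻¹ • y) * ‖V y‖ ^ 2 := fun R =>
    integral_nonneg fun y => mul_nonneg (h0 _) (sq_nonneg _)
  have hN0 : ∀ R, 0 < R → 0 ≤ N R := fun R hR => mul_nonneg (Real.rpow_nonneg hR.le _) (hI0 R)
  have hN3 : ∀ R, 1 ≤ R → N R ≤ 3 * c' := by
    intro R hR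
    have h := EnergySaturation.normEnergy_le_of_growth_loc (ρ := ρ) h0 h1 hzero hVm hA hR
    have h3 : (3 : ℝ) ^ (1 - 2 * ρ) ≤ 3 := by
      conv_rhs => rw [← Real.rpow_one 3]
      exact Real.rpow_le_rpow_of_exponent_le (by norm_num) (by linarith)
    exact h.trans (by gcongr)
  -- ### the flux bound of the energy-saturation chain
  obtain ⟨A, hA0, hflux⟩ := EnergySaturation.exists_fluxWeight_le_of_sup_loc hρ hρ1 hσ h0 h1 hone hzero hVm hPm hGm hVG
    hA hE hD hPoisson
  set a : ℝ := (2 + ρ) / 4 with hadef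
  have ha0 : 0 < a := by rw [hadef]; positivity
  have hαabs : 0 < |α| := abs_pos.2 hα
  set B₀ : ℝ := A / ((2 + ρ) * (2 * |α|)) with hB₀
  have hB₀0 : 0 ≤ B₀ := by rw [hB₀]; positivity
  -- ### KEY (no scale ODE needed): `2α I(R) = F_σ(R)` and the flux bound give `N(R) ≤ B₀ S^{1/2} L^{-a}` on `[L, ∞)`
  have hkey : ∀ L : ℝ, 1 ≤ L → ∀ S : ℝ, 0 ≤ S → S ≤ 3 * c' → (∀ R, L ≤ R → N R ≤ S) →
      ∀ R, L ≤ R → N R ≤ B₀ * S ^ (1 / 2 : ℝ) * L ^ (-a) := by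
    intro L hL S hS hS3 hSsup R hR
    have hL0 : 0 < L := lt_of_lt_of_le one_pos hL
    have hR0 : 0 < R := lt_of_lt_of_le hL0 hR
    have hS12 : 0 ≤ S ^ (1 / 2 : ℝ) := Real.rpow_nonneg hS _
    have hsup' : ∀ R' : ℝ, L ≤ R' → ∫ y, σ (R'⁻¹ • y) * ‖V y‖ ^ 2 ≤ R' ^ (1 - 2 * ρ) * S := by
      intro R' hR'
      have hR'0 : 0 < R' := lt_of_lt_of_le hL0 hR'
      have h := hSsup R' hR'
      have hRR : R' ^ (1 - 2 * ρ) * R' ^ (2 * ρ - 1) = 1 := by rw [← Real.rpow_add hR'0]; norm_num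
      calc ∫ y, σ (R'⁻¹ • y) * ‖V y‖ ^ 2 = R' ^ (1 - 2 * ρ) * N R' := by
            simp only [hN]; rw [← mul_assoc, hRR, one_mul]
        _ ≤ R' ^ (1 - 2 * ρ) * S := mul_le_mul_of_nonneg_left h (Real.rpow_nonneg hR'0.le _)
    have hfr := hflux S hS hS3 L hL hsup' R hR
    set F : ℝ := ∫ x, (‖V x‖ ^ 2 + 2 * P x) * ⟪V x, gradient (fun z => σ (R⁻¹ • z)) x⟫ with hF
    have hpos : 0 < (2 + ρ) * R ^ (2 * ρ - 2) := by positivity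
    have hFle : |F| ≤ A * S ^ (1 / 2 : ℝ) * R ^ (-1 - (2 + ρ) / 4) / ((2 + ρ) * R ^ (2 * ρ - 2)) := by
      rw [le_div_iff₀ hpos]
      have : |(2 + ρ) * R ^ (2 * ρ - 2) * F| = |F| * ((2 + ρ) * R ^ (2 * ρ - 2)) := by
        rw [abs_mul, abs_of_pos hpos, mul_comm]
      rw [← this]
      exact hfr
    have hI : ∫ y, σ (R⁻¹ • y) * ‖V y‖ ^ 2 = F / (2 * α) := by
      have h := hEEσ R hR0
      rw [← hF] at h
      rw [eq_div_iff (mul_ne_zero two_ne_zero hα)]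
      linarith
    have hexp : R ^ (2 * ρ - 1) * R ^ (-1 - (2 + ρ) / 4) / R ^ (2 * ρ - 2) = R ^ (-a) := by
      rw [← Real.rpow_add hR0, ← Real.rpow_sub hR0, hadef]
      congr 1; ring
    have hRa : R ^ (-a) ≤ L ^ (-a) := Real.rpow_le_rpow_of_nonpos hL0 hR (by linarith)
    simp only [hN]
    rw [hI]
    calc R ^ (2 * ρ - 1) * (F / (2 * α)) ≤ R ^ (2 * ρ - 1) * (|F| / (2 * |α|)) := by
          refine mul_le_mul_of_nonneg_left ?_ (Real.rpow_nonneg hR0.le _)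
          have e : |F| / (2 * |α|) = |F / (2 * α)| := by rw [abs_div, abs_mul, abs_two]
          rw [e]; exact le_abs_self _
      _ ≤ R ^ (2 * ρ - 1) * (A * S ^ (1 / 2 : ℝ) * R ^ (-1 - (2 + ρ) / 4) / ((2 + ρ) * R ^ (2 * ρ - 2)) / (2 * |α|)) := by
          gcongr
      _ = B₀ * S ^ (1 / 2 : ℝ) * (R ^ (2 * ρ - 1) * R ^ (-1 - (2 + ρ) / 4) / R ^ (2 * ρ - 2)) := by
          rw [hB₀]
          field_simp
      _ = B₀ * S ^ (1 / 2 : ℝ) * R ^ (-a) := by rw [hexp]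
      _ ≤ B₀ * S ^ (1 / 2 : ℝ) * L ^ (-a) := mul_le_mul_of_nonneg_left hRa (by positivity)
  -- ### ABSORPTION: the tail supremum on `[L, ∞)` is at most `B₀² L^{-2a}`
  -- (verbatim from `EnergySaturation.ae_eq_zero_of_subExtremal_loc`)
  have hdecay : ∀ L : ℝ, 1 ≤ L → N L ≤ B₀ ^ 2 * (L ^ (-a)) ^ 2 := by
    intro L hL
    have hL0 : 0 < L := lt_of_lt_of_le one_pos hL
    set T : Set ℝ := N '' Ici L with hT
    have hTne : T.Nonempty := ⟨N L, L, Set.self_mem_Ici, rfl⟩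
    have hTbdd : BddAbove T := ⟨3 * c', by
      rintro _ ⟨R, hR, rfl⟩; exact hN3 R (hL.trans (Set.mem_Ici.1 hR))⟩
    set S : ℝ := sSup T with hSdef
    have hSsup : ∀ R, L ≤ R → N R ≤ S := fun R hR => le_csSup hTbdd ⟨R, Set.mem_Ici.2 hR, rfl⟩
    have hS0 : 0 ≤ S := (hN0 L hL0).trans (hSsup L le_rfl)
    have hS3 : S ≤ 3 * c' := csSup_le hTne (by
      rintro _ ⟨R, hR, rfl⟩; exact hN3 R (hL.trans (Set.mem_Ici.1 hR)))
    have hSle : S ≤ B₀ * S ^ (1 / 2 : ℝ) * L ^ (-a) :=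
      csSup_le hTne (by rintro _ ⟨R, hR, rfl⟩; exact hkey L hL S hS0 hS3 hSsup R (Set.mem_Ici.1 hR))
    have habs := EnergySaturation.le_sq_of_le_mul_sqrt hS0 hB₀0 (Real.rpow_nonneg hL0.le _) hSle
    exact (hSsup L le_rfl).trans habs
  -- ### CONCLUSION: the energy of every ball vanishes (verbatim from `EnergySaturation.ae_eq_zero_of_subExtremal_loc`)
  have hballzero : ∀ L₀ : ℝ, 0 < L₀ → ∫⁻ y in ball (0 : EuclideanSpace ℝ (Fin 3)) L₀, ‖V y‖ₑ ^ 2 = 0 := by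
    intro L₀ hL₀
    refine le_antisymm (ENNReal.le_of_forall_pos_le_add fun δ hδ _ => ?_) zero_le
    rw [zero_add]
    have hexp : (1 - 2 * ρ) + -(2 * a) < 0 := by rw [hadef]; linarith
    have htend : Tendsto (fun L : ℝ => B₀ ^ 2 * L ^ ((1 - 2 * ρ) + -(2 * a))) atTop (𝓝 (B₀ ^ 2 * 0)) := by
      refine tendsto_const_nhds.mul ?_
      have := tendsto_rpow_neg_atTop (y := -((1 - 2 * ρ) + -(2 * a))) (by linarith)
      simpa using this
    rw [mul_zero] at htend
    have hev := (htend.eventually (gt_mem_nhds (show (0 : ℝ) < δ from hδ))).and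
      (eventually_ge_atTop (max L₀ 1))
    obtain ⟨L, hLδ, hLge⟩ := hev.exists
    have hL1 : 1 ≤ L := (le_max_right _ _).trans hLge
    have hL0 : 0 < L := lt_of_lt_of_le one_pos hL1
    have hLL₀ : L₀ ≤ L := (le_max_left _ _).trans hLge
    have h1 := EnergySaturation.lintegral_ball_sq_le_cutoffEnergy hσs.continuous hσc h0 hone hV2 hL0
    have hNL := hdecay L hL1
    have hI : ∫ y, σ (L⁻¹ • y) * ‖V y‖ ^ 2 ≤ B₀ ^ 2 * L ^ ((1 - 2 * ρ) + -(2 * a)) := by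
      have hRR : L ^ (1 - 2 * ρ) * L ^ (2 * ρ - 1) = 1 := by rw [← Real.rpow_add hL0]; norm_num
      have e2 : (L ^ (-a)) ^ 2 = L ^ (-(2 * a)) := by
        rw [← Real.rpow_natCast, ← Real.rpow_mul hL0.le]; norm_num; ring_nf
      calc ∫ y, σ (L⁻¹ • y) * ‖V y‖ ^ 2 = L ^ (1 - 2 * ρ) * N L := by
            simp only [hN]; rw [← mul_assoc, hRR, one_mul]
        _ ≤ L ^ (1 - 2 * ρ) * (B₀ ^ 2 * (L ^ (-a)) ^ 2) :=
            mul_le_mul_of_nonneg_left hNL (Real.rpow_nonneg hL0.le _)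
        _ = B₀ ^ 2 * (L ^ (1 - 2 * ρ) * L ^ (-(2 * a))) := by rw [e2]; ring
        _ = B₀ ^ 2 * L ^ ((1 - 2 * ρ) + -(2 * a)) := by rw [← Real.rpow_add hL0]
    calc ∫⁻ y in ball (0 : EuclideanSpace ℝ (Fin 3)) L₀, ‖V y‖ₑ ^ 2
        ≤ ∫⁻ y in ball (0 : EuclideanSpace ℝ (Fin 3)) L, ‖V y‖ₑ ^ 2 := lintegral_mono_set (ball_subset_ball hLL₀)
      _ ≤ ENNReal.ofReal (∫ y, σ (L⁻¹ • y) * ‖V y‖ ^ 2) := h1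
      _ ≤ ENNReal.ofReal (B₀ ^ 2 * L ^ ((1 - 2 * ρ) + -(2 * a))) := ENNReal.ofReal_le_ofReal hI
      _ ≤ (δ : ℝ≥0∞) := by
          rw [← ENNReal.ofReal_coe_nnreal]; exact ENNReal.ofReal_le_ofReal hLδ.le
  -- ### hence `V = 0` (a.e., then everywhere by continuity) and `u = 0`
  have hball_ae : ∀ n : ℕ, ∀ᵐ y ∂(volume.restrict (ball (0 : EuclideanSpace ℝ (Fin 3)) ((n : ℝ) + 1))), V y = 0 := by
    intro n
    have h := hballzero ((n : ℝ) + 1) (by positivity)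
    rw [lintegral_eq_zero_iff' (hVm.restrict.enorm.pow_const 2)] at h
    filter_upwards [h] with y hy
    simpa using hy
  have hunion : (⋃ n : ℕ, ball (0 : EuclideanSpace ℝ (Fin 3)) ((n : ℝ) + 1)) = univ := by
    refine eq_univ_of_forall fun y => mem_iUnion.2 ?_
    obtain ⟨n, hn⟩ := exists_nat_gt ‖y‖
    exact ⟨n, by rw [mem_ball, dist_zero_right]; linarith⟩
  have hVae := (ae_restrict_iUnion_iff (μ := (volume : Measure (EuclideanSpace ℝ (Fin 3))))
    (fun n : ℕ => ball (0 : EuclideanSpace ℝ (Fin 3)) ((n : ℝ) + 1)) (fun y => V y = 0)).2 hball_ae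
  rw [hunion, Measure.restrict_univ] at hVae
  exact (Continuous.ae_eq_iff_eq volume hVc continuous_const).1 hVae

end ClassicalProfile

end Summit.NavierStokesRegularity.NavierStokesRegularity.Theorems.PowerGaugeEulerLiouville

end
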